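import Summits.HodgeConjecture.CorCM.Census.TypeStabiliserSquareRoots

/-!
# The cyclic-factor law: `𝒦` of `G × C` for a factor `C` of exponent `2ᵏ`

COR-CM (cell `pub-hodgecm2`), count-neutral kernel combinatorics by the census seat lit-andre-3 (gen 22; lane
TYPE-STABILISER-CYCLICFACTOR), sequel of `Census/TypeStabiliserSquareRoots.lean` (the case `C = ℤ/4`).  Pure group theory, valid in
every group; theorems only (no definition, no `decide`, no certificate, no named fact, no `sorry`).  HONEST FRAMING: `HC_CM` is NOT
proved, here or anywhere in the tree; nothing here is a period or a headline.

THE LAW.  Let `c ∈ G` with `c² = 1 ≠ c`, and let `C` be any group killed by `2ᵏ` that has an element `g` of order exactly `2ᵏ` (every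
exponent killing `g` is divisible by `2ᵏ`) — e.g. `C = ℤ/2ᵏ`.  Then

  **`𝒦(G × C, (c,1)) = (𝒦(G,c) ⊔ ⟨{q | q^(2ᵏ) = 1, c ∈ ⟨q⟩}⟩) × C`**        (`stabGen_prod_eq_of_exponent`, `stabGen_prod_zmod_eq`),

i.e. **passing from `G` to `G × ℤ/2ᵏ` kills, in `G/𝒦`, exactly the images of the roots of `c` of order at most `2ᵏ`**
(`index_stabGen_prod_eq_of_exponent`).  Mechanism: `(q, g)` with `q^(2ᵏ) = 1` is not a root of `(c,1)` (a power `(q,g)ᵐ = (c,1)` needs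
`2ᵏ ∣ m`, `notMem_zpowers_prod_of_pow_eq_one`), while `p ∈ G` with `c ∉ ⟨p^(2ᵏ)⟩` lies in `𝒦 ⊔ ⟨roots of order ≤ 2ᵏ⟩`
(`mem_sup_roots_of_notMem_zpowers_pow`, by Bézout: if `c = pᴺ` with `N = 2ʲ·m`, `m` odd, then `j < k`, `q = pᵐ` is a root of `c` with
`q^(2ᵏ) = 1`, `r = p^(2ʲ⁺¹)` is killed by the odd exponent `m` and so lies in `𝒦`, and `p = rᵘ qᵛ` from `2ʲ⁺¹ u + m v = 1`).

WHY IT IS RECORDED (lane memo `HOME/pub-hodgecm2-lit-andre-3/PORTFOLIO-lit-andre-3-g22.md`, §7bis (3)): together with the gen-21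
pair of order `2¹³` (`G/𝒦 ≅ Q₈ × Q₈`) the case `k = 2` exhibits `(ℤ/2)⁴` as a quotient `G/𝒦` (order `2¹⁵`); the general `k` says that no
larger cyclic factor does more than killing further layers of roots.  Nothing about particular groups is asserted in this file.

## References
* [Pohlmann1968] H. Pohlmann, Algebraic cycles on abelian varieties of complex multiplication type, Ann. of Math. 88 (1968), Thm 1.
* [Milne1999] J. S. Milne, Lefschetz motives and the Tate conjecture, Compositio Math. 117 (1999), Prop. 2.1, p. 54.
-/

namespace Summit.HodgeConjecture.CorCM.Census.TypeStabiliser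

section CyclicFactor

variable {G : Type*} [Group G] (c : G) {C : Type*} [Group C]

/-! ## §1 Products with an arbitrary second factor -/

/-- `(1, t)` is never a root of `(c, 1)` (`c ≠ 1`). [folklore] -/
theorem notMem_zpowers_inr (hc1 : c ≠ 1) (t : C) :
    ((c, (1 : C)) : G × C) ∉ Subgroup.zpowers (((1 : G), t) : G × C) := by
  intro h
  obtain ⟨k, hk⟩ := Subgroup.mem_zpowers_iff.mp h
  have h1 := congrArg Prod.fst hk
  simp only [Prod.pow_fst, one_zpow] at h1
  exact hc1 h1.symm

/-- `(p, t)` is a root of `(c, 1)` only if `p` is a root of `c`. [folklore] -/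
theorem mem_zpowers_fst_of_mem_zpowers {p : G} {t : C}
    (h : ((c, (1 : C)) : G × C) ∈ Subgroup.zpowers ((p, t) : G × C)) : c ∈ Subgroup.zpowers p := by
  obtain ⟨k, hk⟩ := Subgroup.mem_zpowers_iff.mp h
  have h1 := congrArg Prod.fst hk
  simp only [Prod.pow_fst] at h1
  exact Subgroup.mem_zpowers_iff.mpr ⟨k, h1⟩

/-- `1 × C ≤ 𝒦(G × C, (c,1))`. [folklore] -/
theorem inr_mem_stabGen (hc1 : c ≠ 1) (t : C) :
    (((1 : G), t) : G × C) ∈ stabGen ((c, (1 : C)) : G × C) :=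
  mem_stabGen_of_notMem_zpowers _ (notMem_zpowers_inr c hc1 t)

/-- `𝒦(G,c) × 1 ≤ 𝒦(G × C, (c,1))`. [folklore] -/
theorem map_inl_stabGen_le :
    (stabGen c).map (MonoidHom.inl G C) ≤ stabGen ((c, (1 : C)) : G × C) := by
  rw [stabGen, MonoidHom.map_closure, Subgroup.closure_le]
  rintro x ⟨g, hg, rfl⟩
  rcases hg with hg | hg
  · rw [Set.mem_singleton_iff] at hg
    rw [hg]
    exact self_mem_stabGen _
  · exact mem_stabGen_of_notMem_zpowers _ fun h => hg (mem_zpowers_fst_of_mem_zpowers c h)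

/-- **The key non-root.**  If `qⁿ = 1` and every exponent killing `g ∈ C` is divisible by `n`, then `(q, g)` is not a root of
`(c, 1)`: `(q,g)ᵐ = (c,1)` gives `n ∣ m` and then `qᵐ = 1 ≠ c`. [folklore] -/
theorem notMem_zpowers_prod_of_pow_eq_one (hc1 : c ≠ 1) {q : G} {n : ℕ} (hq : q ^ n = 1) {g : C}
    (hg : ∀ m : ℤ, g ^ m = 1 → (n : ℤ) ∣ m) :
    ((c, (1 : C)) : G × C) ∉ Subgroup.zpowers ((q, g) : G × C) := by
  intro h
  obtain ⟨m, hm⟩ := Subgroup.mem_zpowers_iff.mp h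
  have h1 := congrArg Prod.fst hm
  have h2 := congrArg Prod.snd hm
  simp only [Prod.pow_fst] at h1
  simp only [Prod.pow_snd] at h2
  obtain ⟨s, rfl⟩ := hg m h2
  rw [zpow_mul, zpow_natCast, hq, one_zpow] at h1
  exact hc1 h1.symm

/-- With `q`, `g` as above, `(q, 1) = (q, g)·(1, g)⁻¹ ∈ 𝒦(G × C, (c,1))`. [folklore] -/
theorem prod_one_mem_stabGen_of_pow_eq_one (hc1 : c ≠ 1) {q : G} {n : ℕ} (hq : q ^ n = 1) {g : C}
    (hg : ∀ m : ℤ, g ^ m = 1 → (n : ℤ) ∣ m) :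
    ((q, (1 : C)) : G × C) ∈ stabGen ((c, (1 : C)) : G × C) := by
  have h1 : ((q, g) : G × C) ∈ stabGen ((c, (1 : C)) : G × C) :=
    mem_stabGen_of_notMem_zpowers _ (notMem_zpowers_prod_of_pow_eq_one c hc1 hq hg)
  have h3 := Subgroup.mul_mem _ h1 (Subgroup.inv_mem _ (inr_mem_stabGen c hc1 g))
  have heq : ((q, g) : G × C) * (((1 : G), g) : G × C)⁻¹ = (q, 1) := by
    rw [Prod.inv_mk, Prod.mk_mul_mk, inv_one, mul_one, mul_inv_cancel]
  rwa [heq] at h3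

/-! ## §2 The `2ᵏ`-th power criterion -/

/-- **The `2ᵏ`-th power criterion**: if `c ∉ ⟨p^(2ᵏ)⟩` then `p ∈ 𝒦 ⊔ ⟨{q | q^(2ᵏ) = 1, c ∈ ⟨q⟩}⟩` (for `c² = 1 ≠ c`).
If `c ∉ ⟨p⟩` then `p ∈ 𝒦`.  Otherwise `c = pᴺ` with `N = 2ʲ m`, `m` odd, `N ≠ 0`; `j ≥ k` would put `c` in `⟨p^(2ᵏ)⟩`, so `j < k`;
`q := pᵐ` has `q^(2ʲ) = c`, hence `q^(2ᵏ) = 1` and `c ∈ ⟨q⟩`; `r := p^(2ʲ⁺¹)` has `rᵐ = c² = 1` with `m` odd, so `r ∈ 𝒦`; and Bézout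
`2ʲ⁺¹ u + m v = 1` gives `p = rᵘ qᵛ`. [folklore] -/
theorem mem_sup_roots_of_notMem_zpowers_pow (hc2 : c * c = 1) (hc1 : c ≠ 1) (k : ℕ) {p : G}
    (hp : c ∉ Subgroup.zpowers (p ^ (2 ^ k))) :
    p ∈ stabGen c ⊔ Subgroup.closure {q : G | q ^ (2 ^ k) = 1 ∧ c ∈ Subgroup.zpowers q} := by
  by_cases h : c ∈ Subgroup.zpowers p
  swap
  · exact Subgroup.mem_sup_left (mem_stabGen_of_notMem_zpowers c h)
  -- an exponent `N : ℕ`, `N ≠ 0`, with `p ^ N = c`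
  obtain ⟨N, hN0, hN⟩ : ∃ N : ℕ, N ≠ 0 ∧ p ^ N = c := by
    obtain ⟨n, hn⟩ := Subgroup.mem_zpowers_iff.mp h
    have hcinv : c⁻¹ = c := (mul_eq_one_iff_eq_inv.mp hc2).symm
    refine ⟨n.natAbs, ?_, ?_⟩
    · intro h0
      rw [Int.natAbs_eq_zero.mp h0, zpow_zero] at hn
      exact hc1 hn.symm
    · rcases Int.natAbs_eq n with hcase | hcase
      · rw [← zpow_natCast, ← hcase, hn]
      · have : (n.natAbs : ℤ) = -n := by omega
        rw [← zpow_natCast, this, zpow_neg, hn, hcinv]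
  obtain ⟨j, m, hm, hNjm⟩ := Nat.exists_eq_two_pow_mul_odd hN0
  -- `q := p ^ m` is a root of `c` killed by `2^(j+1)`
  have hq : (p ^ m) ^ (2 ^ j) = c := by rw [← pow_mul, mul_comm, ← hNjm, hN]
  have hq2 : (p ^ m) ^ (2 ^ (j + 1)) = 1 := by rw [pow_succ, pow_mul, hq, pow_two, hc2]
  -- `j < k`
  have hjk : j + 1 ≤ k := by
    by_contra hlt
    apply hp
    obtain ⟨e, he⟩ := Nat.exists_eq_add_of_le (show k ≤ j by omega)
    have hce : (p ^ (2 ^ k)) ^ (2 ^ e * m) = c := by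
      rw [← pow_mul, ← mul_assoc, ← pow_add, ← he, ← hNjm, hN]
    rw [← hce]
    exact Subgroup.npow_mem_zpowers _ _
  have hqk : (p ^ m) ^ (2 ^ k) = 1 := by
    obtain ⟨e, he⟩ := Nat.exists_eq_add_of_le hjk
    rw [he, pow_add, pow_mul, hq2, one_pow]
  have hqS : p ^ m ∈ Subgroup.closure {q : G | q ^ (2 ^ k) = 1 ∧ c ∈ Subgroup.zpowers q} := by
    apply Subgroup.subset_closure
    refine ⟨hqk, ?_⟩
    rw [← hq]
    exact Subgroup.npow_mem_zpowers _ _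
  -- `r := p ^ 2^(j+1)` is killed by the odd exponent `m`, hence lies in `𝒦`
  have hr : (p ^ (2 ^ (j + 1))) ^ (m : ℤ) = 1 := by
    have hNm : 2 ^ (j + 1) * m = N * 2 := by rw [hNjm]; ring
    rw [zpow_natCast, ← pow_mul, hNm, pow_mul, hN, pow_two, hc2]
  have hrK : p ^ (2 ^ (j + 1)) ∈ stabGen c := mem_stabGen_of_zpow_odd c hc2 hc1 hm.natCast hr
  -- Bézout
  have hcop : Nat.Coprime (2 ^ (j + 1)) m := (Nat.coprime_two_left.mpr hm).pow_left (j + 1)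
  obtain ⟨u, v, huv⟩ := Nat.isCoprime_iff_coprime.mpr hcop
  rw [mul_comm u, mul_comm v] at huv
  have hp1 : p = (p ^ (2 ^ (j + 1))) ^ u * (p ^ m) ^ v := by
    conv_lhs => rw [← zpow_one p, ← huv]
    rw [zpow_add, zpow_mul, zpow_mul, zpow_natCast, zpow_natCast]
  rw [hp1]
  exact Subgroup.mul_mem _ (Subgroup.mem_sup_left (Subgroup.zpow_mem _ hrK _))
    (Subgroup.mem_sup_right (Subgroup.zpow_mem _ hqS _))

/-! ## §3 The cyclic-factor law -/

/-- **THE CYCLIC-FACTOR LAW.**  Let `c² = 1 ≠ c`, let `C` be a group killed by `2ᵏ` containing an element `g` every exponent killing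
which is divisible by `2ᵏ`.  Then `𝒦(G × C, (c,1)) = (𝒦(G,c) ⊔ ⟨{q | q^(2ᵏ) = 1, c ∈ ⟨q⟩}⟩) × C`.
(≤): a non-root `(p,t)` of `(c,1)` has `c ∉ ⟨p^(2ᵏ)⟩` (as `(p,t)^(2ᵏ s) = (p^(2ᵏ s), 1)`), then §2.  (≥): §1. [folklore] -/
theorem stabGen_prod_eq_of_exponent (hc2 : c * c = 1) (hc1 : c ≠ 1) (k : ℕ) (hC : ∀ t : C, t ^ (2 ^ k) = 1)
    {g : C} (hg : ∀ m : ℤ, g ^ m = 1 → ((2 ^ k : ℕ) : ℤ) ∣ m) :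
    stabGen ((c, (1 : C)) : G × C) =
      (stabGen c ⊔ Subgroup.closure {q : G | q ^ (2 ^ k) = 1 ∧ c ∈ Subgroup.zpowers q}).prod ⊤ := by
  apply le_antisymm
  · rw [stabGen_le_iff_subset]
    refine ⟨Subgroup.mem_prod.mpr ⟨Subgroup.mem_sup_left (self_mem_stabGen c), Subgroup.mem_top _⟩, ?_⟩
    rintro ⟨p, t⟩ hpt
    refine Subgroup.mem_prod.mpr ⟨mem_sup_roots_of_notMem_zpowers_pow c hc2 hc1 k fun h => hpt ?_, Subgroup.mem_top _⟩
    obtain ⟨s, hs⟩ := Subgroup.mem_zpowers_iff.mp h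
    refine Subgroup.mem_zpowers_iff.mpr ⟨((2 ^ k : ℕ) : ℤ) * s, ?_⟩
    rw [Prod.pow_mk, zpow_mul, zpow_mul, zpow_natCast, zpow_natCast, hs, hC t, one_zpow]
  · rintro ⟨p, t⟩ hpt
    obtain ⟨hp, -⟩ := Subgroup.mem_prod.mp hpt
    have heq : ((p, t) : G × C) = (p, 1) * (1, t) := by
      rw [Prod.mk_mul_mk, mul_one, one_mul]
    rw [heq]
    refine Subgroup.mul_mem _ ?_ (inr_mem_stabGen c hc1 t)
    have hmap : (stabGen c ⊔ Subgroup.closure {q : G | q ^ (2 ^ k) = 1 ∧ c ∈ Subgroup.zpowers q}).map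
        (MonoidHom.inl G C) ≤ stabGen ((c, (1 : C)) : G × C) := by
      rw [Subgroup.map_sup, sup_le_iff, MonoidHom.map_closure, Subgroup.closure_le]
      refine ⟨map_inl_stabGen_le c, ?_⟩
      rintro x ⟨q, ⟨hq, -⟩, rfl⟩
      exact prod_one_mem_stabGen_of_pow_eq_one c hc1 hq hg
    exact hmap (Subgroup.mem_map_of_mem _ hp)

/-- **Index form**: `[G × C : 𝒦(G × C, (c,1))] = [G : 𝒦(G,c) ⊔ ⟨roots of c of order ≤ 2ᵏ⟩]`. [folklore] -/
theorem index_stabGen_prod_eq_of_exponent (hc2 : c * c = 1) (hc1 : c ≠ 1) (k : ℕ) (hC : ∀ t : C, t ^ (2 ^ k) = 1)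
    {g : C} (hg : ∀ m : ℤ, g ^ m = 1 → ((2 ^ k : ℕ) : ℤ) ∣ m) :
    (stabGen ((c, (1 : C)) : G × C)).index =
      (stabGen c ⊔ Subgroup.closure {q : G | q ^ (2 ^ k) = 1 ∧ c ∈ Subgroup.zpowers q}).index := by
  rw [stabGen_prod_eq_of_exponent c hc2 hc1 k hC hg, Subgroup.index_prod, Subgroup.index_top, mul_one]

/-- If all roots of `c` of order `≤ 2ᵏ` already lie in `𝒦(G,c)` (e.g. `k = 0`, or `c` has no proper roots), then
`𝒦(G × C, (c,1)) = 𝒦(G,c) × C` and `G/𝒦` is unchanged. [folklore] -/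
theorem stabGen_prod_eq_of_roots_mem (hc2 : c * c = 1) (hc1 : c ≠ 1) (k : ℕ) (hC : ∀ t : C, t ^ (2 ^ k) = 1)
    {g : C} (hg : ∀ m : ℤ, g ^ m = 1 → ((2 ^ k : ℕ) : ℤ) ∣ m)
    (h : ∀ q : G, q ^ (2 ^ k) = 1 → c ∈ Subgroup.zpowers q → q ∈ stabGen c) :
    stabGen ((c, (1 : C)) : G × C) = (stabGen c).prod ⊤ := by
  rw [stabGen_prod_eq_of_exponent c hc2 hc1 k hC hg]
  congr 1
  exact le_antisymm (sup_le le_rfl ((Subgroup.closure_le _).mpr fun q hq => h q hq.1 hq.2)) le_sup_left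

/-! ## §4 The factor `ℤ/2ᵏ` -/

/-- Every element of `Multiplicative (ZMod (2^k))` is killed by `2ᵏ`. [folklore] -/
theorem zmod_two_pow_pow_eq_one (k : ℕ) (t : Multiplicative (ZMod (2 ^ k))) : t ^ (2 ^ k) = 1 := by
  have h : (2 ^ k) • (Multiplicative.toAdd t) = 0 := by
    rw [nsmul_eq_mul]
    have : ((2 ^ k : ℕ) : ZMod (2 ^ k)) = 0 := ZMod.natCast_self (2 ^ k)
    rw [Nat.cast_pow] at this
    rw [Nat.cast_pow, this, zero_mul]
  have := congrArg Multiplicative.ofAdd h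
  rwa [ofAdd_nsmul, ofAdd_toAdd, ofAdd_zero] at this

/-- A power of the generator `ofAdd 1` of `Multiplicative (ZMod (2^k))` is trivial only for exponents divisible by `2ᵏ`. [folklore] -/
theorem two_pow_dvd_of_gen_zpow_eq_one (k : ℕ) {m : ℤ} (hm : (Multiplicative.ofAdd (1 : ZMod (2 ^ k))) ^ m = 1) :
    ((2 ^ k : ℕ) : ℤ) ∣ m := by
  rw [← ofAdd_zsmul, zsmul_eq_mul, mul_one] at hm
  have hm' : ((m : ZMod (2 ^ k))) = 0 := by
    have := congrArg Multiplicative.toAdd hm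
    rwa [toAdd_ofAdd, toAdd_one] at this
  exact (ZMod.intCast_zmod_eq_zero_iff_dvd m (2 ^ k)).mp hm'

/-- **THE CYCLIC-FACTOR LAW for `ℤ/2ᵏ`**: `𝒦(G × ℤ/2ᵏ, (c,1)) = (𝒦(G,c) ⊔ ⟨{q | q^(2ᵏ) = 1, c ∈ ⟨q⟩}⟩) × ℤ/2ᵏ`; so
`(G × ℤ/2ᵏ)/𝒦 ≅ G/(𝒦 ⊔ ⟨roots of c of order ≤ 2ᵏ⟩)`. [folklore] -/
theorem stabGen_prod_zmod_eq (hc2 : c * c = 1) (hc1 : c ≠ 1) (k : ℕ) :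
    stabGen ((c, (1 : Multiplicative (ZMod (2 ^ k)))) : G × Multiplicative (ZMod (2 ^ k))) =
      (stabGen c ⊔ Subgroup.closure {q : G | q ^ (2 ^ k) = 1 ∧ c ∈ Subgroup.zpowers q}).prod ⊤ :=
  stabGen_prod_eq_of_exponent c hc2 hc1 k (zmod_two_pow_pow_eq_one k)
    fun _ hm => two_pow_dvd_of_gen_zpow_eq_one k hm

/-- Index form for `ℤ/2ᵏ`. [folklore] -/
theorem index_stabGen_prod_zmod_eq (hc2 : c * c = 1) (hc1 : c ≠ 1) (k : ℕ) :
    (stabGen ((c, (1 : Multiplicative (ZMod (2 ^ k)))) : G × Multiplicative (ZMod (2 ^ k)))).index =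
      (stabGen c ⊔ Subgroup.closure {q : G | q ^ (2 ^ k) = 1 ∧ c ∈ Subgroup.zpowers q}).index :=
  index_stabGen_prod_eq_of_exponent c hc2 hc1 k (zmod_two_pow_pow_eq_one k)
    fun _ hm => two_pow_dvd_of_gen_zpow_eq_one k hm

end CyclicFactor

end Summit.HodgeConjecture.CorCM.Census.TypeStabiliser
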